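import Summits.ABC.IUTFork.Conditional.HexRefutedBandMTwinsL
import Summits.ABC.IUTFork.Conditional.HexRefutedLowCells
import HarnessLib

/-!
# HEX family, M LINE: S_H at the summand-route M-level setting REFUTED at every genuine datum over `(ratPoint (1/2 + 2/7^k), l)` for EVERY prime
# `11 ≤ l ≤ L₀(k)`, k ∈ {33} — the M twins of the K glue theorems `GenuineK.not_pilotKummerCompatHull_chosen_lamSeven_<k>_le` (row «W:REF-EXACT-M-TWIN», HEX part)

PROOF-ONLY file (D-0012; 0 definitions, 0 `Prop` facts, no instance) of the abc-iut cell — D-0079 RESCUE sub-cell R-W «WINDOW Θ-SIDE INEQUALITY», seat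
abc-iut-W-neg-1 (gen 7). TAKES NO SIDE on [IUTchIII] Cor. 3.12 (S. Mochizuki, *Inter-universal Teichmüller theory III*, Cor. 3.12 p. 173–174; Step (xi-f)
p. 184) or on any author; «refuted as typed» ≠ «refuted in print». For each `k`, the K-line glue theorem (abc-iut-C-cert-1 / abc-iut-w6-d055
`WRowHexLamSeven<K>RefutedBand`) covers `11 ≤ l ≤ L₀(k)` by abc-iut-W-neg-2's explicit-depth rad theorem `HexRad.…_rad_eleven` on `l ≤ 479` (and, for
`k = 10, 12`, abc-iut-rh-typ-4's pinned hull-cell theorems on the middle ranges) and by the class-robust hull-cell band from `481` (`883`, `3363`) on. On the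
M line EVERY piece goes through ONE engine — this seat's `GenuineM.not_pilotKummerCompatHull_triple_of_hullCells_tameSharp` (`AbcOfSGenuineMHullCellsTriple`,
p528325) — with the integer cells `RefBand.cells_hex_low` (k-uniform, `HexRefutedLowCells`), `RefBand.cells_hex10_mid` / `RefBand.cells_hex12_mid`
(`HexRefutedMidCells`) and the band twins `GenuineM.not_pilotKummerCompatHull_triple_lamSeven_<k>_band` (`HexRefutedBandMTwins*`, cells BY NAME). SAME
binders as the K theorems (the M place over `7` is `placeOfPrimeQ 7`). READING (neutral): at these `(λ_k, l)` the M books' per-datum S_H object (binder `hSHw` of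
`Conditional.abc_of_SH_v11M_window` / `…_szpiroBadAll`) FAILS at EVERY genuine datum, exactly as the K books' does; the inhabited side, admissibility /
(P6) / NON-EMPTINESS are NOT claimed; record counts UNCHANGED. HONEST SCOPE: OUR sharp containers and Dupuy–Hilado's typed (Ind1)/(Ind2); STRONGER-THAN-PRINT
set-level reading of Step (xi-f); nothing about the printed GLOBAL inequality, the number-level `Cor22.Cor312AtDatum` or any author's intended hull;
typed ≠ proved; instantiated ≠ endorsed; no abc claim. [cite: Mochizuki2012, IUTchI Ex. 3.2 (iv) p. 71; IUTchIII Cor. 3.12 Step (xi-f) p. 184; IUTchIV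
Prop. 1.1 p. 9, Prop. 1.2 (i)(ii) p. 10, Cor. 2.2 (ii) proof (P5) p. 46] [cite: DupuyHilado2025, §3.4, §4.9, §4.12] [claim: Mochizuki2012, status: disputed]
for every IUT sentence.
-/

noncomputable section

open Set Function Metric NumberField IsDedekindDomain

namespace Summit.ABC.IUTFork.Conditional

open Thm311 Thm311.Real Cor312 Cor312Vol Cor312Prov Literature.IUT.LogThetaLattice Literature.IUT.LogVolume
  Literature.IUT.HodgeTheaters Literature.IUT.LogVolume.ThetaData Literature.IUT.LogVolume.Cor22
open Literature.NumberTheory.NumberFields Literature.NumberTheory.GaloisRepresentations.Ultrametric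
open Literature.NumberTheory.DiophantineGeometry Literature.NumberTheory.DiophantineGeometry.GenEll Summit.ABC.ABC.Theorems
open Summit.ABC.IUTFork.Repair.RH.HullThresholdExact

/-- **HEX `k = 33`, M LINE: S_H at the summand-route M-level setting of the datum's OWN ideles REFUTED at EVERY genuine datum over `(ratPoint (1/2 + 2/7^33), l)`
for EVERY prime `11 ≤ l ≤ 4984939585357`** — the M twin of `GenuineK.not_pilotKummerCompatHull_chosen_lamSeven_thirtyThree_le`, SAME binders. GLUE (all through this seat's
M hull-cell engine `GenuineM.not_pilotKummerCompatHull_triple_of_hullCells_tameSharp`, p528325): `l ≤ 479` by the k-uniform low cells `RefBand.cells_hex_low`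
(on the K line this range is abc-iut-W-neg-2's rad theorem, which has no M twin);
`481 … 4984939585357` by the band twin `GenuineM.not_pilotKummerCompatHull_triple_lamSeven_thirtyThree_band` (cells of abc-iut-C-cert-1 / abc-iut-w6-d055 BY NAME). The
inhabited side, admissibility / (P6) / non-emptiness are NOT claimed; refuted-as-typed only. [cite: Mochizuki2012, IUTchIII Cor. 3.12 Step (xi-f) p. 184]
[cite: DupuyHilado2025, §4.9] [claim: Mochizuki2012, status: disputed] -/
theorem GenuineM.not_pilotKummerCompatHull_triple_lamSeven_thirtyThree_le {k l : ℕ} (hk : k = 33) (hl : l.Prime) (h11 : 11 ≤ l) (h4984939585357 : l ≤ 4984939585357)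
    (T : Cor22.ThetaVolumeDatumAt (ratPoint ((2 : ℚ)⁻¹ + 2 / 7 ^ k)) l) :
    letI := T.instFieldF; letI := T.instNumberFieldF; letI := T.instAlgebraF; letI := T.instFieldK
    letI := T.instNumberFieldK; letI := T.instAlgebraK; letI := T.instFieldFbar; letI := T.instAlgebraFbar
    letI := T.instAlgebraKFbar; letI := T.instIsElliptic
    ∀ (M : Type) [Field M] [NumberField M]
      (archPk : ∀ (j : (thetaIndexOfInitial T.D).Label) (vQ : (thetaIndexOfInitial T.D).VQ),
        Set ((logShellsOfInitialDH T.D (analyticLogvVal T.K)).Packet j vQ))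
      (archSub : ∀ (j : (thetaIndexOfInitial T.D).Label) (v : (thetaIndexOfInitial T.D).V),
        Set ((logShellsOfInitialDH T.D (analyticLogvVal T.K)).Packet j ((thetaIndexOfInitial T.D).over v)))
      (Ψ : ℤ → ∀ v : (thetaIndexOfInitial T.D).V, v ∈ (thetaIndexOfInitial T.D).Vbad →
        Set ((logShellsOfInitialDH T.D (analyticLogvVal T.K)).StarPacket v))
      (act : ℤ → ∀ v : (thetaIndexOfInitial T.D).V, v ∈ (thetaIndexOfInitial T.D).Vbad →
        (logShellsOfInitialDH T.D (analyticLogvVal T.K)).StarPacket v →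
          Module.End ℚ ((logShellsOfInitialDH T.D (analyticLogvVal T.K)).StarPacket v))
      (Mmod : ℤ → ∀ j : (thetaIndexOfInitial T.D).LabelStar, Set ((logShellsOfInitialDH T.D (analyticLogvVal T.K)).GlobalPacket j.1))
      (region : ℤ → ∀ j : (thetaIndexOfInitial T.D).LabelStar, FinDivisor M → ∀ vQ : (thetaIndexOfInitial T.D).VQ,
        Set ((logShellsOfInitialDH T.D (analyticLogvVal T.K)).Packet j.1 vQ))
      (frobAdm : ℤ → ℤ → ∀ (j : (thetaIndexOfInitial T.D).Label) (vQ : (thetaIndexOfInitial T.D).VQ),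
        Set ((logShellsOfInitialDH T.D (analyticLogvVal T.K)).Packet j vQ) → Prop)
      (frobLogvol : ℤ → ℤ → ∀ (j : (thetaIndexOfInitial T.D).Label) (vQ : (thetaIndexOfInitial T.D).VQ),
        Set ((logShellsOfInitialDH T.D (analyticLogvVal T.K)).Packet j vQ) → ℝ)
      (frobΨ : ℤ → ℤ → ∀ v : (thetaIndexOfInitial T.D).V, v ∈ (thetaIndexOfInitial T.D).Vbad →
        Set ((logShellsOfInitialDH T.D (analyticLogvVal T.K)).StarPacket v))
      (frobMmod : ℤ → ℤ → ∀ j : (thetaIndexOfInitial T.D).LabelStar, Set ((logShellsOfInitialDH T.D (analyticLogvVal T.K)).GlobalPacket j.1))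
      (unitImage : ℤ → ℤ → ℕ → ∀ (j : (thetaIndexOfInitial T.D).Label) (vQ : (thetaIndexOfInitial T.D).VQ),
        Set ((logShellsOfInitialDH T.D (analyticLogvVal T.K)).Packet j vQ))
      (ballImage : ℤ → ℤ → ∀ (j : (thetaIndexOfInitial T.D).Label) (vQ : (thetaIndexOfInitial T.D).VQ),
        Set ((logShellsOfInitialDH T.D (analyticLogvVal T.K)).Packet j vQ))
      (thetaDiv : ℤ → ℤ → LgpDivisor M (thetaIndexOfInitial T.D).lstar)
      (n : ℤ) {HT : Type} {LogLink : HT → HT → Type} {IsFull : ∀ {s t : HT}, LogLink s t → Prop}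
      (lat : LGPGaussianLogThetaLattice LogLink IsFull)
      {Frd : Type} {IsoF : Frd → Frd → Type} {Ob : Frd → Type} {realify : Frd → Frd} {Strip : Type}
      {IsoS : Strip → Strip → Type} {Mv : ∀ v : (thetaIndexOfInitial T.D).V, v ∈ (thetaIndexOfInitial T.D).Vbad → Type}
      [∀ v h, Monoid (Mv v h)]
      (sig : GlobalLGPFrobenioidSignature (thetaIndexOfInitial T.D).lstar (thetaIndexOfInitial T.D).V
        (· ∈ (thetaIndexOfInitial T.D).Vbad) Frd IsoF Ob realify Strip IsoS Mv)
      (split : SplittingMonoids Mv) {ObΔ : Type} {N : ∀ v : (thetaIndexOfInitial T.D).V, v ∈ (thetaIndexOfInitial T.D).Vbad → Type}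
      [∀ v h, Monoid (N v h)] (qData : QPilotData ObΔ N)
      (qK : ∀ v : (thetaIndexOfInitial T.D).V, v ∈ (thetaIndexOfInitial T.D).Vbad →
        Set ((logShellsOfInitialDH T.D (analyticLogvVal T.K)).StarPacket v)),
      ¬ Cor312Vol.PilotKummerCompatHull
        (LatticeSituation.ofShells (logShellsOfInitialDH T.D (analyticLogvVal T.K)) M archPk archSub
          (summandPiecesPrM T.D (logvAnalyticVal_analyticLogvVal (K := T.K))).Adm (summandPiecesPrM T.D (logvAnalyticVal_analyticLogvVal (K := T.K))).logvol Ψ act Mmod region frobAdm frobLogvol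
          frobΨ frobMmod unitImage ballImage thetaDiv)
        (settingPrVolSharpM T.D (logvAnalyticVal_analyticLogvVal (K := T.K)) (tOfIdeleData T.D (ideleDataOf T.D T.isVolumeInputOf))
          (fun u x => tqM T.D (ratChar u) u (natCast_ratChar_mem u) (ideleDataOf T.D T.isVolumeInputOf) x) M archPk archSub Ψ act Mmod region n lat sig split qData
          (fun u x => tqM_ne_zero T.D (ratChar u) u (natCast_ratChar_mem u) (ideleDataOf T.D T.isVolumeInputOf) x)
          (GenuineM.finite_ratPlaces_under_S T.D).toFinset
          (fun u x hu => norm_tqM_eq_one_of_not_mem T.D (ratChar u) u (natCast_ratChar_mem u) (ideleDataOf T.D T.isVolumeInputOf) x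
            fun hx => hu ((Set.Finite.mem_toFinset _).mpr ⟨x, hx⟩)))
        (fun _ => Cor312.Setting.qRegion
          (settingPrVolSharpM T.D (logvAnalyticVal_analyticLogvVal (K := T.K)) (tOfIdeleData T.D (ideleDataOf T.D T.isVolumeInputOf))
          (fun u x => tqM T.D (ratChar u) u (natCast_ratChar_mem u) (ideleDataOf T.D T.isVolumeInputOf) x) M archPk archSub Ψ act Mmod region n lat sig split qData
          (fun u x => tqM_ne_zero T.D (ratChar u) u (natCast_ratChar_mem u) (ideleDataOf T.D T.isVolumeInputOf) x)
          (GenuineM.finite_ratPlaces_under_S T.D).toFinset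
          (fun u x hu => norm_tqM_eq_one_of_not_mem T.D (ratChar u) u (natCast_ratChar_mem u) (ideleDataOf T.D T.isVolumeInputOf) x
            fun hx => hu ((Set.Finite.mem_toFinset _).mpr ⟨x, hx⟩)))) qK := by
  have hodd : Odd l := hl.odd_of_ne_two (by omega)
  by_cases h479 : l ≤ 479
  · subst hk
    revert T
    rw [lamSeven_eq_hex33]
    intro T
    exact GenuineM.not_pilotKummerCompatHull_triple_of_hullCells_tameSharp isABCTriple_hex33 T (placeOfPrimeQ 7 (by norm_num)) 7
        (ratChar_placeOfPrimeQ 7 (by norm_num)) (by norm_num) (by norm_num) (by norm_num) (by omega) (by norm_num) factorization_triple_hex33.2.1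
        (i := (l - 1) / 2 - 1) (by omega)
        (fun A hA30 hA15 hAev hA3 hA5 => RefBand.cells_hex_low (k := 33) (by norm_num) h11 h479 hodd (by omega) A hA30 hA15 hAev hA3 hA5)
  · have h481 : 481 ≤ l := by
      rcases hl.eq_two_or_odd with h | h <;> omega
    exact GenuineM.not_pilotKummerCompatHull_triple_lamSeven_thirtyThree_band hk hl h481 h4984939585357 T

end Summit.ABC.IUTFork.Conditional

end
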